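import Literature.Computability.AlgebraicComplexity.BD17DescartesCircuits
import HarnessLib

/-!
# Descartes' rule of signs for families of analytic functions and Wronskians
# (Bihan–Dickenstein 2017, §4.1; Pólya–Szegő)

F. Bihan, A. Dickenstein, *Descartes' rule of signs for polynomial systems supported on circuits*,
Int. Math. Res. Not. IMRN 2017 (22) 6867–6893 = arXiv:1601.05826 [BihanDickenstein2017], §4.1
"A univariate generalization of Descartes' rule of signs and orderings" (held text
`paper:arxiv-1601.05826`, p0010–p0011; printed numbering Def. 4.1, Prop. 4.2, Prop. 4.3,
Lemma 4.4 = flat "Definition 18", "Proposition 19 ([P-S])", "Proposition 20", "Lemma 21",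
concordance `pub/val-lit/lit/CONCORDANCE-printed.md § BD17`). Typed STATEMENTS; sibling of
`BD17DescartesCircuits.lean` (§1–§3, §5), whose vocabulary (`PosConeCond`, `IsOrdering`,
`IsMaxMinorSet`, `restrictOrdering`, `IsGaleDual`) is imported, not restated. This is the tool behind
Thm. 2.9: a sequence of analytic functions `(h_1, …, h_s)` on an open interval satisfies Descartes'
rule of signs iff all its Wronskians are nonvanishing with a sign depending only on the size
(Pólya–Szegő, *Problems and theorems in analysis* II, Part V, items 87 and 90), applied to the
reciprocals `1/p_j` of the Gale-dual linear functions. Typed for the cell `val-lit` (row X4-BD17)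
as a SOURCE for LADDER-VALIANT V1 ideation (Descartes systems / sign-variation bounds for real zeros
of combinations of functions); no val-lit fact depends on it. Honest framing: typed ≠ proved;
nothing here bears on VP versus VNP.

## Coverage (source item → declaration → status)

* Def. 4.1 (p0010:L17 "Definition 18") → `BD17.linComb`, `BD17.rootCountMult` (roots in `Δ` counted
  with multiplicity = order of vanishing, Mathlib's `analyticOrderNatAt`), `BD17.SatisfiesDescartesRule`.
* The Wronskian (p0010:L27) → `BD17.wronskian`.
* **Prop. 4.2** ([P-S] V.87, V.90; p0010:L47 "Proposition 19") → `BD2017_prop_4_2` FACT.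
* `p_j(y) = ⟨P_j, (1, y)⟩` (4.1) → `BD17.galeLin`; `Δ_P = {y : (1,y) ∈ 𝒞_P^ν}` (2.9) →
  `BD17.galeInterval`; **Prop. 4.3** (p0010:L79 "Proposition 20") → `BD2017_prop_4_3` FACT.
* **Lemma 4.4** (p0010:L123 "Lemma 21") → `BD2017_lem_4_4` FACT (a statement about the sign
  variation of finite sequences alone).
* §4.2 (the proof of Thm. 2.9, the vectors `B^i`, `P^i`) — proof material, not typed.

## Faithfulness sheet (typed vs printed, per declaration)

* `SatisfiesDescartesRule`: FAITHFUL, with the coefficient sequence required NONZERO (`a ≠ 0`; for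
  `a = 0` the printed sentence would bound the roots of the zero function by `sgnvar(0) = 0` — the
  source [P-S] excludes it); roots are counted with multiplicity (`analyticOrderNatAt`), and "never
  exceeds" includes the finiteness of the zero set in `Δ`.
* `wronskian`: FAITHFUL ("the `(i,j)` coefficient is the `(i−1)`-th derivative of `h_j`").
* `BD2017_prop_4_2`: FAITHFUL; "open interval" = open connected subset of `ℝ`; the collections
  `1 ≤ j_1 < ⋯ < j_ℓ ≤ s` are strictly monotone maps `Fin ℓ → Fin s` (the print's "`≤ k`" in
  condition (2) is read as "`≤ s`", an evident typo); "`W ≠ 0`", "`W · W' > 0`" are read pointwise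
  on `Δ`.
* `galeLin`, `galeInterval`: FAITHFUL ((4.1), (2.9) with the normalisation of Rem. 2.4 that
  `Δ_P ≠ ∅`, made a hypothesis of Prop. 4.3).
* `BD2017_prop_4_3`: FAITHFUL ("With the previous hypotheses and notations": `C` of rank `n` with
  (1.5), an ordering `α`, `K` and `ᾱ` as in §2.3, a Gale dual with `Δ_P ≠ ∅`).
* `BD2017_lem_4_4`: FAITHFUL ("is the minimum of the quantities `s_q`" = "`≤` every `s_q` and `=`
  some `s_q`"; the three displayed cases of `s_q` are the single formula
  `1 + sgnvar(−c_0, …, −c_{q−1}, c_{q+1}, …, c_{k−1})`).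

## References

* [BihanDickenstein2017] F. Bihan, A. Dickenstein, *Descartes' rule of signs for polynomial
  systems supported on circuits*, IMRN 2017 (22) 6867–6893; arXiv:1601.05826, §4.1.
* G. Pólya, G. Szegő, *Problems and theorems in analysis II*, Springer 1976, Part V items 87, 90
  (the source of Prop. 4.2, as cited in print).
-/

noncomputable section

open Matrix Finset
open Literature.Algebra.Polynomial (signVar)

namespace Literature.Computability.AlgebraicComplexity

namespace BD17

/-! ### Def. 4.1: Descartes' rule of signs for a sequence of functions -/

/-- The combination `a_1 h_1 + a_2 h_2 + ⋯ + a_s h_s` of a sequence of functions.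
[cite: BihanDickenstein2017, Def. 4.1] -/
def linComb {s : ℕ} (a : Fin s → ℝ) (h : Fin s → ℝ → ℝ) : ℝ → ℝ :=
  fun y => ∑ i, a i * h i y

/-- The number of roots of `f` in `Δ` **counted with multiplicity** (the multiplicity of a root of an
analytic function being its order of vanishing, Mathlib's `analyticOrderNatAt`); junk `0` when the
zero set in `Δ` is infinite (then the printed "number of roots" is infinite — the typed rule below
also demands finiteness). [cite: BihanDickenstein2017, Def. 4.1] -/
def rootCountMult (f : ℝ → ℝ) (Δ : Set ℝ) : ℕ :=
  ∑ᶠ y ∈ {y | y ∈ Δ ∧ f y = 0}, analyticOrderNatAt f y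

/-- **BD 2017, Def. 4.1** (p0010:L17): "A sequence `(h_1, h_2, …, h_s)` of real valued analytic
functions defined on an open interval `Δ ⊂ ℝ` satisfies Descartes' rule of signs on `Δ` if for any
sequence `a = (a_1, a_2, …, a_s)` of real numbers, the number of roots of `a_1h_1 + a_2h_2 + ⋯ + a_sh_s`
in `Δ` counted with multiplicity never exceeds `sgnvar(a)`." (For `a ≠ 0`; see the module
docstring.) [cite: BihanDickenstein2017, Def. 4.1] -/
def SatisfiesDescartesRule {s : ℕ} (h : Fin s → ℝ → ℝ) (Δ : Set ℝ) : Prop :=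
  ∀ a : Fin s → ℝ, a ≠ 0 →
    {y | y ∈ Δ ∧ linComb a h y = 0}.Finite ∧
      rootCountMult (linComb a h) Δ ≤ signVar (List.ofFn a)

/-- The **Wronskian** `W(h_1, …, h_s)(y) = det (h_j^{(i−1)}(y))_{1 ≤ i, j ≤ s}` ("The `(i,j)`
coefficient is the `(i−1)`-th derivative of `h_j`", p0010:L37; `0`-based here: entry `(i, j)` is the
`i`-th derivative of `h_j`). [cite: BihanDickenstein2017, §4.1 (before Prop. 4.2)] -/
def wronskian {s : ℕ} (h : Fin s → ℝ → ℝ) (y : ℝ) : ℝ :=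
  (Matrix.of fun i j : Fin s => iteratedDeriv i.val (h j) y).det

/-! ### (4.1), (2.9): the Gale-dual linear functions and the interval `Δ_P` -/

variable {n : ℕ}

/-- `p_j(y) = ⟨P_j, (1, y)⟩ = P_{j,1} + P_{j,2} y` (4.1), for the rows `P_j` of a Gale dual matrix
`B`. [cite: BihanDickenstein2017, §4.1 eq. (4.1)] -/
def galeLin (B : Matrix (Fin (n + 2)) (Fin 2) ℝ) (j : Fin (n + 2)) (y : ℝ) : ℝ :=
  B j 0 + B j 1 * y

/-- `Δ_P = {y ∈ ℝ : (1, y) ∈ 𝒞_P^ν}` (2.9), `𝒞_P^ν = {μ : ⟨P_i, μ⟩ > 0 ∀ i}` (Rem. 2.4): the set where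
all `p_j` are positive (an open interval, assumed nonempty after the normalisation of Rem. 2.4).
[cite: BihanDickenstein2017, Rem. 2.4 eq. (2.9)] -/
def galeInterval (B : Matrix (Fin (n + 2)) (Fin 2) ℝ) : Set ℝ :=
  {y | ∀ j : Fin (n + 2), 0 < galeLin B j y}

end BD17

open BD17

/-! ### §4.1 Statements (named facts) -/

section Facts

/-- **BD 2017, Prop. 4.2 ([P-S], Part V, items 87 and 90)** (p0010:L47 "Proposition 19"): "A sequence
of functions `h_1, …, h_s` satisfies Descartes' rule of signs on `Δ ⊂ ℝ` if and only if for any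
collection of integers `1 ≤ j_1 < j_2 < ⋯ < j_ℓ ≤ s` we have `W(h_{j_1}, …, h_{j_ℓ}) ≠ 0` (1), and
for any collections of integers `1 ≤ j_1 < ⋯ < j_ℓ ≤ s` and `1 ≤ j'_1 < ⋯ < j'_ℓ ≤ s` of the same
size, we have `W(h_{j_1}, …, h_{j_ℓ}) · W(h_{j'_1}, …, h_{j'_ℓ}) > 0` (2)." (Setting of Def. 4.1:
the `h_i` real analytic on the open interval `Δ`.) [cite: BihanDickenstein2017, Prop. 4.2] -/
def BD2017_prop_4_2 : Prop :=
  ∀ (s : ℕ) (h : Fin s → ℝ → ℝ) (Δ : Set ℝ), IsOpen Δ → IsConnected Δ →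
    (∀ i, AnalyticOnNhd ℝ (h i) Δ) →
      (SatisfiesDescartesRule h Δ ↔
        (∀ (ℓ : ℕ) (J : Fin ℓ → Fin s), StrictMono J →
          ∀ y ∈ Δ, wronskian (fun b => h (J b)) y ≠ 0) ∧
        (∀ (ℓ : ℕ) (J J' : Fin ℓ → Fin s), StrictMono J → StrictMono J' →
          ∀ y ∈ Δ, 0 < wronskian (fun b => h (J b)) y * wronskian (fun b => h (J' b)) y))

/-- **BD 2017, Prop. 4.3** (p0010:L79 "Proposition 20"): for a full rank `C ∈ ℝ^{n×(n+2)}` satisfying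
(1.5), an ordering `α` of `C`, `K` and the restricted ordering `ᾱ : [k] → K` as in §2.3, and a Gale
dual configuration `P_0, …, P_{n+1}` of `C` with `Δ_P ≠ ∅`: "the collection of nonzero rational
functions `(1/p_{ᾱ_0}, 1/p_{ᾱ_1}, …, 1/p_{ᾱ_{k−1}})` satisfies Descartes' rule of signs on `Δ_P`."
[cite: BihanDickenstein2017, Prop. 4.3] -/
def BD2017_prop_4_3 : Prop :=
  ∀ (n : ℕ) (C : Matrix (Fin n) (Fin (n + 2)) ℝ), C.rank = n → PosConeCond C →
    ∀ α : Equiv.Perm (Fin (n + 2)), IsOrdering C α →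
    ∀ K : Finset (Fin (n + 2)), IsMaxMinorSet C K →
    ∀ B : Matrix (Fin (n + 2)) (Fin 2) ℝ, IsGaleDual C B → (galeInterval B).Nonempty →
      SatisfiesDescartesRule
        (fun i : Fin K.card => fun y => 1 / galeLin B (restrictOrdering α K i) y) (galeInterval B)

/-- **BD 2017, Lemma 4.4** (p0010:L123 "Lemma 21"): "Let `s = (c_0, c_1, …, c_{k−1})` be a sequence of
real numbers such that the sign variation `sgnvar(s)` is nonzero. Then `sgnvar(s)` is the minimum of
the quantities `s_q`, `q ∈ [k]`, defined by `s_0 = 1 + sgnvar(c_1, …, c_{k−1})`,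
`s_{k−1} = 1 + sgnvar(−c_0, …, −c_{k−2})`, and
`s_q = 1 + sgnvar(−c_0, …, −c_{q−1}, c_{q+1}, …, c_{k−1})`, `q = 1, …, k − 2`."
[cite: BihanDickenstein2017, Lemma 4.4] -/
def BD2017_lem_4_4 : Prop :=
  ∀ l : List ℝ, signVar l ≠ 0 →
    (∀ q : ℕ, q < l.length →
      signVar l ≤ 1 + signVar ((l.take q).map (fun c => -c) ++ l.drop (q + 1))) ∧
    ∃ q : ℕ, q < l.length ∧
      signVar l = 1 + signVar ((l.take q).map (fun c => -c) ++ l.drop (q + 1))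

end Facts

end Literature.Computability.AlgebraicComplexity
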